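import Literature.AlgebraicGeometry.Frobenioids.GroupSubfunctors
import Literature.AlgebraicGeometry.Frobenioids.GroupificationBridge
import Literature.AlgebraicGeometry.Frobenioids.MonoidFunctorsOnD
import Mathlib.GroupTheory.QuotientGroup.Basic
import HarnessLib

/-!
# Frobenioids I, Theorem 6.4 (ii), first step: the isomorphism `Pic_Φ(A₁) ⥲ Pic_Φ(A₂)` induced by an
# isomorphism of monoids over a base functor

Mochizuki, *The geometry of Frobenioids I: the general theory*, Kyushu J. Math. **62** (2008)
293–400, kurims text: Thm. 6.4 (ii) p. 114 and its proof p. 115 l. 34 – p. 116 l. 3: "the isomorphism of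
groups `Pic_Φ(A₁) ⥲ Pic_Φ(A₂)` determined by `Ψ^rlf` [cf. assertion (i); Corollary 4.10; Corollary 4.11,
(iii)] … arises from an isomorphism of monoids `Φ₁^rlf(A₁) ⥲ Φ₂^rlf(A₂)`"; Thm. 5.1 (i) p. 96:
"`Pic_Φ(A) := Φ^gp(A)/Φ^birat(A)`" [cite: MochizukiFrdI2008, Thm. 6.4 (ii) p.115].

PROOF-ONLY file (seat abc-iut-w4-d086, L1 row (E) = sub-DAG `plan/L1/SUBDAG-FrdI-Thm64.md` row T64ii/L01,
"the induced picMap, compatibility picMap ∘ (class map) = (class map) ∘ monoid iso"), in the generic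
vocabulary of `GroupSubfunctors.lean` (seat abc-iut-L1-t5: `GpSubfunctor Φ`, `Ψ.Pic X = Φ^gp(X)/Ψ(X)`,
`Ψ.picPull`). Given monoids `Φ_i` on `D_i`, subfunctors of groups `Ψ_i ⊆ Φ_i^gp`, a functor
`Ψ^Base : D₁ ⥤ D₂` and a family of isomorphisms of monoids `e_X : Φ₁(X) ⥲ Φ₂(Ψ^Base X)` natural in `X`
(the shape of the `Ψ^Φ` "lying over `Ψ^Base`" of Cor. 4.11 (iii), `PreFrobenioidData.DivisorMonoidIsoOverBase`)
whose groupification carries `Ψ₁(X)` onto `Ψ₂(Ψ^Base X)` (for the realifications: `ℝ · Φ₁^birat` onto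
`ℝ · Φ₂^birat`, the hypothesis `hspan` of `FrdI.Cor54Sub.realSpanMapOver`), we prove:

* `GpSubfunctor.exists_pic_mulEquiv_of_monoidIso` — there are isomorphisms of groups
  `π_X : Φ₁^gp(X)/Ψ₁(X) ⥲ Φ₂^gp(Ψ^Base X)/Ψ₂(Ψ^Base X)` with `π_X [c] = [e_X^gp c]` (so `π_X ∘ cl₁ = cl₂ ∘ e_X`
  on the classes of elements of the monoids — "arises from an isomorphism of monoids") which are natural
  with respect to the pull-back maps `Ψ_i.picPull` ("the maps `Φ(θ)` on `Pic_Φ`", Thm. 5.1 (ii));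
* `GpSubfunctor.pic_mulEquiv_unique` — such `π` is unique (classes of monoid elements generate).

Plain group theory (`QuotientGroup.congr`); no new definitions; nothing of the paper is restated; nothing
here is specific to the abc programme and no side is taken on [IUTchIII] Cor. 3.12.
-/

namespace Literature.AlgebraicGeometry.Frobenioids

open CategoryTheory Opposite

universe w v₁ v₂ u₁ u₂

namespace GpSubfunctor

variable {D₁ : Type u₁} [Category.{v₁} D₁] {D₂ : Type u₂} [Category.{v₂} D₂]
  {Φ₁ : D₁ᵒᵖ ⥤ CommMonCat.{w}} {Φ₂ : D₂ᵒᵖ ⥤ CommMonCat.{w}}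

/-- The groupification `e^gp : Φ₁(X)^gp → Φ₂(Y)^gp` of an isomorphism of monoids is bijective (functoriality
of `M ↦ M^gp`, §0 p. 11). [cite: MochizukiFrdI2008, §0 p.11] -/
theorem monGp_map_bijective_of_mulEquiv {M N : Type w} [CommMonoid M] [CommMonoid N] (e : M ≃* N) :
    Function.Bijective (MonGp.map e.toMonoidHom) := by
  rw [MonGp.map_eq_gpMap]
  exact gpMap_bijective_of_bijective _ e.bijective

/-- Naturality of the groupified family `e^gp` with respect to the pull-back maps `Φ_i(f)` on `Φ_i^gp`,
from the naturality of `e` on the monoids. [cite: MochizukiFrdI2008, Cor. 4.11 (iii) p.92] -/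
theorem monGp_map_pullGp_of_natural (ΨBase : D₁ ⥤ D₂)
    (e : ∀ X : D₁, Φ₁.obj (op X) ≃* Φ₂.obj (op (ΨBase.obj X)))
    (hnat : ∀ ⦃X Y : D₁⦄ (f : Y ⟶ X) (x : Φ₁.obj (op X)),
      e Y ((Φ₁.map f.op).hom x) = (Φ₂.map (ΨBase.map f).op).hom (e X x))
    ⦃X Y : D₁⦄ (f : Y ⟶ X) (c : Algebra.GrothendieckGroup (Φ₁.obj (op X))) :
    MonGp.map (e Y).toMonoidHom (pullGp Φ₁ f c) = pullGp Φ₂ (ΨBase.map f) (MonGp.map (e X).toMonoidHom c) := by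
  have key : (MonGp.map (e Y).toMonoidHom).comp (pullGp Φ₁ f) =
      (pullGp Φ₂ (ΨBase.map f)).comp (MonGp.map (e X).toMonoidHom) := by
    apply MonGp.hom_ext
    intro a
    simp only [MonoidHom.comp_apply, pullGp_of, MonGp.map_of, MulEquiv.coe_toMonoidHom]
    exact congrArg Algebra.GrothendieckGroup.of (hnat f a)
  exact DFunLike.congr_fun key c

/-- **[FrdI] Thm. 6.4 (ii), first step (sub-DAG T64ii/L01): the isomorphism `Pic_Φ(A₁) ⥲ Pic_Φ(A₂)`
"arises from an isomorphism of monoids".** For subfunctors of groups `Ψ_i ⊆ Φ_i^gp` and a family of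
isomorphisms of monoids `e_X : Φ₁(X) ⥲ Φ₂(Ψ^Base X)` natural in `X` whose groupification carries `Ψ₁(X)`
onto `Ψ₂(Ψ^Base X)`, there are isomorphisms `π_X : Φ₁^gp(X)/Ψ₁(X) ⥲ Φ₂^gp(Ψ^Base X)/Ψ₂(Ψ^Base X)` with
`π_X [c] = [e_X^gp c]`, natural with respect to the pull-back maps on `Pic` (Thm. 5.1 (ii)).
[cite: MochizukiFrdI2008, Thm. 6.4 (ii) p.115] -/
theorem exists_pic_mulEquiv_of_monoidIso (Ψ₁ : GpSubfunctor Φ₁) (Ψ₂ : GpSubfunctor Φ₂) (ΨBase : D₁ ⥤ D₂)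
    (e : ∀ X : D₁, Φ₁.obj (op X) ≃* Φ₂.obj (op (ΨBase.obj X)))
    (hnat : ∀ ⦃X Y : D₁⦄ (f : Y ⟶ X) (x : Φ₁.obj (op X)),
      e Y ((Φ₁.map f.op).hom x) = (Φ₂.map (ΨBase.map f).op).hom (e X x))
    (hspan : ∀ X : D₁,
      (Ψ₁.carrier X).map (MonGp.map (e X).toMonoidHom) = Ψ₂.carrier (ΨBase.obj X)) :
    ∃ π : ∀ X : D₁, Ψ₁.Pic X ≃* Ψ₂.Pic (ΨBase.obj X),
      (∀ (X : D₁) (c : Algebra.GrothendieckGroup (Φ₁.obj (op X))),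
          π X (QuotientGroup.mk c) = QuotientGroup.mk (MonGp.map (e X).toMonoidHom c)) ∧
      (∀ ⦃X Y : D₁⦄ (f : Y ⟶ X) (x : Ψ₁.Pic X),
          π Y (Ψ₁.picPull f x) = Ψ₂.picPull (ΨBase.map f) (π X x)) := by
  classical
  -- the groupified isomorphisms
  let eGp : ∀ X : D₁, Algebra.GrothendieckGroup (Φ₁.obj (op X)) ≃*
      Algebra.GrothendieckGroup (Φ₂.obj (op (ΨBase.obj X))) :=
    fun X => MulEquiv.ofBijective (MonGp.map (e X).toMonoidHom) (monGp_map_bijective_of_mulEquiv (e X))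
  have heGp : ∀ X, ((eGp X : _ ≃* _) : _ →* _) = MonGp.map (e X).toMonoidHom := fun X => MonoidHom.ext fun _ => rfl
  have hspan' : ∀ X : D₁, (Ψ₁.carrier X).map (eGp X : _ →* _) = Ψ₂.carrier (ΨBase.obj X) := by
    intro X
    rw [heGp]
    exact hspan X
  refine ⟨fun X => QuotientGroup.congr (Ψ₁.carrier X) (Ψ₂.carrier (ΨBase.obj X)) (eGp X) (hspan' X),
    fun X c => rfl, ?_⟩
  intro X Y f x
  induction x using QuotientGroup.induction_on with
  | H c =>
    change QuotientGroup.congr _ _ (eGp Y) (hspan' Y) (Ψ₁.picPull f (QuotientGroup.mk c)) =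
      Ψ₂.picPull (ΨBase.map f) (QuotientGroup.mk (MonGp.map (e X).toMonoidHom c))
    simp only [picPull, QuotientGroup.map_mk, QuotientGroup.congr_mk]
    exact congrArg QuotientGroup.mk (monGp_map_pullGp_of_natural ΨBase e hnat f c)

/-- Uniqueness: an isomorphism (indeed any map) `Pic₁(X) → Pic₂(Ψ^Base X)` is determined by its values on
the classes `[a]` of elements `a ∈ Φ₁(X)` of the MONOID — these generate `Φ₁^gp(X)/Ψ₁(X)` as a group.
[cite: MochizukiFrdI2008, Thm. 6.4 (ii) p.115] -/
theorem pic_monoidHom_ext (Ψ₁ : GpSubfunctor Φ₁) {X : D₁} {G : Type w} [CommGroup G]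
    {g₁ g₂ : Ψ₁.Pic X →* G}
    (h : ∀ a : Φ₁.obj (op X),
      g₁ (QuotientGroup.mk (Algebra.GrothendieckGroup.of a)) = g₂ (QuotientGroup.mk (Algebra.GrothendieckGroup.of a))) :
    g₁ = g₂ := by
  have key : g₁.comp (QuotientGroup.mk' (Ψ₁.carrier X)) = g₂.comp (QuotientGroup.mk' (Ψ₁.carrier X)) :=
    MonGp.hom_ext fun a => h a
  exact MonoidHom.ext fun x => by
    induction x using QuotientGroup.induction_on with
    | H c => exact DFunLike.congr_fun key c

/-- The class-map form used downstream ("picMap ∘ cl₁ = cl₂ ∘ e"): with `cl_i := [·] ∘ (Φ_i ↪ Φ_i^gp)`, the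
isomorphisms `π` of `exists_pic_mulEquiv_of_monoidIso` satisfy `π_X (cl₁ a) = cl₂ (e_X a)` for `a ∈ Φ₁(X)`.
[cite: MochizukiFrdI2008, Thm. 6.4 (ii) p.115] -/
theorem exists_pic_mulEquiv_classMap (Ψ₁ : GpSubfunctor Φ₁) (Ψ₂ : GpSubfunctor Φ₂) (ΨBase : D₁ ⥤ D₂)
    (e : ∀ X : D₁, Φ₁.obj (op X) ≃* Φ₂.obj (op (ΨBase.obj X)))
    (hnat : ∀ ⦃X Y : D₁⦄ (f : Y ⟶ X) (x : Φ₁.obj (op X)),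
      e Y ((Φ₁.map f.op).hom x) = (Φ₂.map (ΨBase.map f).op).hom (e X x))
    (hspan : ∀ X : D₁,
      (Ψ₁.carrier X).map (MonGp.map (e X).toMonoidHom) = Ψ₂.carrier (ΨBase.obj X)) :
    ∃ π : ∀ X : D₁, Ψ₁.Pic X ≃* Ψ₂.Pic (ΨBase.obj X),
      (∀ (X : D₁) (a : Φ₁.obj (op X)),
          π X (QuotientGroup.mk (Algebra.GrothendieckGroup.of a)) =
            QuotientGroup.mk (Algebra.GrothendieckGroup.of (e X a))) ∧
      (∀ (X : D₁) (c : Algebra.GrothendieckGroup (Φ₁.obj (op X))),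
          π X (QuotientGroup.mk c) = QuotientGroup.mk (MonGp.map (e X).toMonoidHom c)) ∧
      (∀ ⦃X Y : D₁⦄ (f : Y ⟶ X) (x : Ψ₁.Pic X),
          π Y (Ψ₁.picPull f x) = Ψ₂.picPull (ΨBase.map f) (π X x)) := by
  obtain ⟨π, hπ, hnatπ⟩ := exists_pic_mulEquiv_of_monoidIso Ψ₁ Ψ₂ ΨBase e hnat hspan
  refine ⟨π, fun X a => ?_, hπ, hnatπ⟩
  rw [hπ, MonGp.map_of, MulEquiv.coe_toMonoidHom]

end GpSubfunctor

end Literature.AlgebraicGeometry.Frobenioids
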